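import Summits.AnomalousDissipation.AnomalousDissipation.Theorems.QuasiStaticSolenoidalCellTensorQ.Negative.WindowStep
import Summits.AnomalousDissipation.AnomalousDissipation.Theorems.QuasiStaticSolenoidalCellTensorQ.Negative.DrainValue
import HarnessLib

/-!
# Negative side of K2Q `QuasiStaticSolenoidalCellTensorQ` (stmt-AnomalousDissipation-19072): chaining the windows — the
# exponential floor of the principal pair at the Galerkin level (helper, `--supports stmt-AnomalousDissipation-19072`)

Summits-side helper file (everything proved; no definitions, no named facts).
* `one_sub_mul_exp_ge_one` — `1 ≤ (1 − a)·e^{a(1+2a)}` for `0 ≤ a ≤ 1/2`;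
* `iterate_floor` — abstract chaining: if every window `[mQ,(m+1)Q]` that starts in the cone `R ≤ ηx`, `x > 0` keeps
  `x ≥ (1−a)x(mQ)` on the window and ends in the cone, then `x(t) ≥ x(0)(1−a)e^{−(a(1+2a)/Q)t}` for all `t ≥ 0`;
* `step_floor_algebra`, `step_cone_algebra` — the scalar bookkeeping of one window (floor `x ≥ (1−a)x(mQ)` with
  `a = η + λ(1+η)Q + d`, `d` the isotropic drain of the window; cone inheritance under `e^{−ΛQ/2} ≤ 1/4`,
  `4d ≤ q(1−4ρ/3)τ_min Λ η`, `a ≤ 1/2`);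
* `window_step_tm` — `window_step` with the rest bound through `Σ_j τ_j Γ_j/τ_min` (the form `drain_value_le` controls).
The concrete chaining for the cell truncation (these four pieces + `drain_value_le`) is the object of the sequel.
This is NOT a proof of anomalous dissipation, and by itself not of `¬ K2Q`.
-/

set_option linter.dupNamespace false

noncomputable section

namespace Summit.AnomalousDissipation.AnomalousDissipation.Theorems.QuasiStaticSolenoidalCellTensorQ.Negative

open Set MeasureTheory Filter Topology Function
open scoped InnerProductSpace ComplexConjugate BigOperators
open Literature.Analysis Literature.Analysis.FunctionSpaces Literature.Analysis.FunctionSpaces.Torus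
open Literature.Analysis.FluidPDE Literature.Analysis.FluidPDE.LatticeShear
open Summit.AnomalousDissipation.AnomalousDissipation.Theorems.SolenoidalFractalHomogenisation.PermissibleCarrier
open Summit.AnomalousDissipation.AnomalousDissipation.Theorems.SolenoidalFractalHomogenisation.RealisedQuasiStaticCellLaw

variable {k₀ : ℕ}

/-! ## §1 Abstract chaining -/

/-- `1 ≤ (1 − a)·exp(a(1+2a))` for `0 ≤ a ≤ 1/2`. -/
theorem one_sub_mul_exp_ge_one {a : ℝ} (ha0 : 0 ≤ a) (ha : a ≤ 1 / 2) : 1 ≤ (1 - a) * Real.exp (a * (1 + 2 * a)) := by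
  have h1 : a * (1 + 2 * a) + 1 ≤ Real.exp (a * (1 + 2 * a)) := Real.add_one_le_exp _
  have h2 : 1 ≤ (1 - a) * (a * (1 + 2 * a) + 1) := by nlinarith [mul_nonneg ha0 ha0, mul_nonneg (mul_nonneg ha0 ha0) (by linarith : (0:ℝ) ≤ 1 - 2 * a)]
  exact h2.trans (mul_le_mul_of_nonneg_left h1 (by linarith))

/-- **Abstract chaining of windows.** -/
theorem iterate_floor {x R : ℝ → ℝ} {Q a η : ℝ} (hQ : 0 < Q) (ha0 : 0 ≤ a) (ha : a ≤ 1 / 2)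
    (hstep : ∀ m : ℕ, R ((m : ℝ) * Q) ≤ η * x ((m : ℝ) * Q) → 0 < x ((m : ℝ) * Q) →
      (∀ t ∈ Icc ((m : ℝ) * Q) (((m : ℝ) + 1) * Q), x ((m : ℝ) * Q) * (1 - a) ≤ x t) ∧
        R (((m : ℝ) + 1) * Q) ≤ η * x (((m : ℝ) + 1) * Q))
    (h0 : R 0 ≤ η * x 0) (hx0 : 0 < x 0) :
    ∀ t, 0 ≤ t → x 0 * (1 - a) * Real.exp (-(a * (1 + 2 * a) / Q) * t) ≤ x t := by
  have h1a : 0 < 1 - a := by linarith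
  -- induction over the windows
  have hind : ∀ m : ℕ, R ((m : ℝ) * Q) ≤ η * x ((m : ℝ) * Q) ∧ 0 < x ((m : ℝ) * Q) ∧
      x 0 * (1 - a) ^ m ≤ x ((m : ℝ) * Q) := by
    intro m
    induction m with
    | zero => simpa using ⟨h0, hx0⟩
    | succ m ih =>
      obtain ⟨hc, hp, hl⟩ := ih
      obtain ⟨hwin, hcone⟩ := hstep m hc hp
      have hend := hwin (((m : ℝ) + 1) * Q) ⟨by nlinarith, le_rfl⟩
      push_cast
      refine ⟨hcone, lt_of_lt_of_le (mul_pos hp h1a) hend, le_trans ?_ hend⟩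
      rw [pow_succ]
      nlinarith [mul_le_mul_of_nonneg_right hl h1a.le]
  intro t ht
  set m : ℕ := ⌊t / Q⌋₊ with hm
  have hm1 : (m : ℝ) * Q ≤ t := by
    have := Nat.floor_le (div_nonneg ht hQ.le); rw [← hm] at this
    exact (le_div_iff₀ hQ).1 this
  have hm2 : t ≤ ((m : ℝ) + 1) * Q := by
    have := Nat.lt_floor_add_one (t / Q); rw [← hm] at this
    exact ((div_lt_iff₀ hQ).1 this).le
  obtain ⟨hc, hp, hl⟩ := hind m
  have hwin := (hstep m hc hp).1 t ⟨hm1, hm2⟩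
  -- `(1-a)^m ≥ exp(-a(1+2a) m) ≥ exp(-(a(1+2a)/Q) t)`
  have hpow : Real.exp (-(a * (1 + 2 * a) / Q) * t) ≤ (1 - a) ^ m := by
    have hmt : (m : ℝ) ≤ t / Q := by rw [le_div_iff₀ hQ]; exact hm1
    have h1 : Real.exp (-(a * (1 + 2 * a) / Q) * t) ≤ Real.exp (-(a * (1 + 2 * a)) * m) := by
      refine Real.exp_le_exp.2 ?_
      have : a * (1 + 2 * a) * (m : ℝ) ≤ a * (1 + 2 * a) * (t / Q) := mul_le_mul_of_nonneg_left hmt (by positivity)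
      have e : a * (1 + 2 * a) / Q * t = a * (1 + 2 * a) * (t / Q) := by field_simp
      rw [neg_mul, neg_mul, e]; linarith
    refine h1.trans ?_
    have h2 : Real.exp (-(a * (1 + 2 * a))) ≤ 1 - a := by
      have h := one_sub_mul_exp_ge_one ha0 ha
      have hpos := Real.exp_pos (a * (1 + 2 * a))
      rw [Real.exp_neg]
      rw [inv_le_iff_one_le_mul₀ hpos]
      linarith
    have h3 : Real.exp (-(a * (1 + 2 * a)) * m) = Real.exp (-(a * (1 + 2 * a))) ^ m := by
      rw [← Real.exp_nat_mul]; ring_nf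
    rw [h3]
    exact pow_le_pow_left₀ (Real.exp_pos _).le h2 m
  calc x 0 * (1 - a) * Real.exp (-(a * (1 + 2 * a) / Q) * t) ≤ x 0 * (1 - a) * (1 - a) ^ m :=
        mul_le_mul_of_nonneg_left hpow (by positivity)
    _ = x 0 * (1 - a) ^ m * (1 - a) := by ring
    _ ≤ x ((m : ℝ) * Q) * (1 - a) := mul_le_mul_of_nonneg_right hl h1a.le
    _ ≤ x t := hwin

/-! ## §2 Scalar bookkeeping of one window -/

/-- `Σ_j G_j ≤ (Σ_j τ_j G_j)/τm` for `G ≥ 0` and `τ_j ≥ τm > 0`. -/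
theorem sum_le_sum_mul_div {ι : Type*} [Fintype ι] (G τ : ι → ℝ) {τm : ℝ} (hτm : 0 < τm) (hG : ∀ j, 0 ≤ G j)
    (hτ : ∀ j, τm ≤ τ j) : ∑ j, G j ≤ (∑ j, τ j * G j) / τm := by
  rw [le_div_iff₀ hτm, Finset.sum_mul]
  exact Finset.sum_le_sum fun j _ => by nlinarith [hG j, hτ j]

/-- **Floor algebra of one window.** -/
theorem step_floor_algebra {xm Rm xt S F Cθ nv B E Q lam η ε qρ t t0 d : ℝ}
    (hxv : xm = 2 * nv) (hwin : xm - Rm - lam * (xm + Rm) * (t - t0) - 4 * (qρ * S) ≤ xt)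
    (ht : t - t0 ≤ Q) (ht0 : 0 ≤ t - t0) (hdrain : S ≤ F * ((1 + ε) * Cθ * nv + B)) (hB : B ≤ (1 + 1 / ε) * (E * (xm + Rm) * Q ^ 2))
    (hc : Rm ≤ η * xm) (hxm : 0 ≤ xm) (hlam : 0 ≤ lam) (hη : 0 ≤ η) (hε : 0 < ε) (hqρ : 0 ≤ qρ) (hF : 0 ≤ F)
    (hE : 0 ≤ E)
    (hd : d = 4 * qρ * F * ((1 + ε) * Cθ / 2 + (1 + 1 / ε) * (E * (1 + η) * Q ^ 2))) :
    xm * (1 - (η + lam * (1 + η) * Q + d)) ≤ xt ∧ 4 * (qρ * S) ≤ xm * d := by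
  have hε' : 0 ≤ 1 + 1 / ε := by positivity
  have hxR : xm + Rm ≤ (1 + η) * xm := by linarith
  have hB' : B ≤ (1 + 1 / ε) * (E * ((1 + η) * xm) * Q ^ 2) := by
    refine hB.trans (mul_le_mul_of_nonneg_left ?_ hε')
    nlinarith [mul_le_mul_of_nonneg_left hxR (mul_nonneg hE (sq_nonneg Q)), sq_nonneg Q]
  have hS : 4 * (qρ * S) ≤ xm * d := by
    rw [hd]
    have h1 : (1 + ε) * Cθ * nv + B ≤ xm * ((1 + ε) * Cθ / 2 + (1 + 1 / ε) * (E * (1 + η) * Q ^ 2)) := by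
      rw [hxv] at hB' ⊢; nlinarith
    have h2 := mul_le_mul_of_nonneg_left (hdrain.trans (mul_le_mul_of_nonneg_left h1 hF)) hqρ
    nlinarith
  refine ⟨?_, hS⟩
  have h3 : lam * (xm + Rm) * (t - t0) ≤ lam * ((1 + η) * xm) * Q :=
    mul_le_mul (mul_le_mul_of_nonneg_left hxR hlam) ht ht0 (by positivity)
  nlinarith

/-- **Cone algebra at the end of one window.** -/
theorem step_cone_algebra {xm Rm x1 R1 S e1 Λ τm η qρ d a : ℝ}
    (hrest : R1 ≤ Rm * e1 + 4 * S / (τm * Λ)) (hS : 4 * (qρ * S) ≤ xm * d) (hx1 : xm * (1 - a) ≤ x1)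
    (hc : Rm ≤ η * xm) (hxm : 0 ≤ xm) (hRm : 0 ≤ Rm) (hη : 0 ≤ η) (he1 : e1 ≤ 1 / 4)
    (hτm : 0 < τm) (hΛ : 0 < Λ) (hqρ : 0 < qρ) (hbudget : 4 * d ≤ qρ * τm * Λ * η) (ha : a ≤ 1 / 2) :
    R1 ≤ η * x1 := by
  have h1 : Rm * e1 ≤ η * xm / 4 := by nlinarith [mul_le_mul_of_nonneg_left he1 hRm]
  have h2 : 4 * S / (τm * Λ) ≤ η * xm / 4 := by
    rw [div_le_iff₀ (mul_pos hτm hΛ)]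
    -- `16 S ≤ η xm τm Λ`: from `4 qρ S ≤ xm d` and `4 d ≤ qρ τm Λ η`
    have h3 : 16 * (qρ * S) ≤ xm * (qρ * τm * Λ * η) := by nlinarith [mul_le_mul_of_nonneg_left hbudget hxm]
    have h4 : 16 * S ≤ xm * (τm * Λ * η) := by
      have := h3; nlinarith [mul_pos hqρ (mul_pos hτm hΛ)]
    nlinarith
  nlinarith

/-! ## §3 The window step with the slot-duration-weighted rest bound -/

set_option maxHeartbeats 1600000 in
/-- `window_step` with the rest bound expressed through `Σ_j τ_j Γ_j` (`Σ_j Γ_j ≤ Σ_j τ_j Γ_j / τ_min`). -/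
theorem window_step_tm (W : LatticeWord k₀) {n : ℕ} (hn : 0 < n) {κ : ℝ} (hκ : 0 < κ)
    (ℓ : Fin 3 → ℤ) (hℓ : ℓ ≠ 0) (hℓn : 2 * ‖latticeVec ℓ‖ < n) {w₀ : UnitAddTorus (Fin 3) → EuclideanSpace ℝ (Fin 3)}
    (hw₀ : FunctionSpaces.Torus.MemSobolev 1 (FunctionSpaces.EuclideanSpace.complexify ∘ w₀))
    (hdiv : FunctionSpaces.Torus.IsWeaklyDivFree w₀) (hmean : FunctionSpaces.Torus.HasZeroMean w₀)
    (hsupp : ∀ k : Fin 3 → ℤ, ¬ ((∃ z : Fin 3 → ℤ, k = ℓ + (n:ℤ) • z) ∨ (∃ z : Fin 3 → ℤ, k = -ℓ + (n:ℤ) • z)) →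
      UnitAddTorus.mFourierCoeff (FunctionSpaces.EuclideanSpace.complexify ∘ w₀) k = 0)
    {N : ℕ} (hBN : (Finset.univ.biUnion fun j : Fin k₀ =>
        ({(fun i => (W.phase j).m i * n), -(fun i => (W.phase j).m i * n)} : Finset (Fin 3 → ℤ))) ⊆ freqBall N)
    (hℓN : ℓ ∈ freqBall N)
    (hball : ∀ j : Fin k₀, ∀ k ∈ ({ℓ, -ℓ} : Finset (Fin 3 → ℤ)),
      k - (fun i => (W.phase j).m i * (n : ℤ)) ∈ freqBall N ∧ k + (fun i => (W.phase j).m i * (n : ℤ)) ∈ freqBall N)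
    {T : ℝ} (p q : ℕ) (hT : ((p : ℝ) + q) * W.period ≤ T) {ε : ℝ} (hε : 0 < ε) {τm : ℝ} (hτm : 0 < τm)
    (hτ : ∀ j, τm ≤ (W.phase j).τ) :
    let α := fun t k => (pvSetup_cell W hn hκ.le ℓ hw₀ hdiv hmean hsupp).galerkinCoeffAt N t k
    let x := fun t => ‖α t ℓ‖ ^ 2 + ‖α t (-ℓ)‖ ^ 2
    let R := fun t => ∑ k ∈ freqBall N \ {ℓ, -ℓ}, ‖α t k‖ ^ 2
    let t₀ := (p : ℝ) * W.period
    let t₁ := ((p : ℝ) + q) * W.period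
    let δ := Real.exp (κ * (4 * Real.pi ^ 2 * freqNormSq ℓ) * (t₁ - t₀)) *
      ((∑ j : Fin k₀, (1 / (n : ℝ)) * (2 * Real.pi * |∑ i, (W.phase j).e i * (ℓ i : ℝ)|) *
          (‖Complex.exp ((W.phase j).φ * Complex.I) *
              (1 / (2 * ((2 * Real.pi * ‖latticeVec (W.phase j).m‖ : ℝ) : ℂ) * Complex.I))‖ +
            ‖starRingEnd ℂ (Complex.exp ((W.phase j).φ * Complex.I)) *
              (-(1 / (2 * ((2 * Real.pi * ‖latticeVec (W.phase j).m‖ : ℝ) : ℂ) * Complex.I)))‖)) *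
        Real.sqrt (x t₀ + R t₀)) * (t₁ - t₀)
    let Γ := fun j : Fin k₀ => (1 / 2 : ℝ) * ((1 / (n : ℝ)) ^ 2 * (2 * Real.pi * ∑ i, (W.phase j).e i * (ℓ i : ℝ)) ^ 2) *
      (‖Complex.exp ((W.phase j).φ * Complex.I) *
          (1 / (2 * ((2 * Real.pi * ‖latticeVec (W.phase j).m‖ : ℝ) : ℂ) * Complex.I))‖ ^ 2 +
        ‖starRingEnd ℂ (Complex.exp ((W.phase j).φ * Complex.I)) *
          (-(1 / (2 * ((2 * Real.pi * ‖latticeVec (W.phase j).m‖ : ℝ) : ℂ) * Complex.I)))‖ ^ 2) *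
      (((1 + ε) * ‖Torus.leraySym (ℓ - (fun i => (W.phase j).m i * n)) (α t₀ ℓ)‖ ^ 2 + (1 + 1 / ε) * δ ^ 2) /
          (κ * (4 * Real.pi ^ 2 * freqNormSq (ℓ - (fun i => (W.phase j).m i * n)))) +
        ((1 + ε) * ‖Torus.leraySym (ℓ + (fun i => (W.phase j).m i * n)) (α t₀ ℓ)‖ ^ 2 + (1 + 1 / ε) * δ ^ 2) /
          (κ * (4 * Real.pi ^ 2 * freqNormSq (ℓ + (fun i => (W.phase j).m i * n)))))
    (∀ t ∈ Icc t₀ t₁, x t₀ - R t₀ - 2 * (κ * (4 * Real.pi ^ 2 * freqNormSq ℓ)) * (x t₀ + R t₀) * (t - t₀) -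
        4 * ((q : ℝ) * (1 - 4 * W.ramp / 3) * ∑ j, (W.phase j).τ * Γ j) ≤ x t) ∧
    (R t₁ ≤ R t₀ * Real.exp (-(2 * (κ * (4 * Real.pi ^ 2 * ((n : ℝ) / 2) ^ 2)) / 2) * (t₁ - t₀)) +
      4 * (∑ j, (W.phase j).τ * Γ j) / (τm * (2 * (κ * (4 * Real.pi ^ 2 * ((n : ℝ) / 2) ^ 2))))) := by
  intro α x R t₀ t₁ δ Γ
  obtain ⟨h1, h2⟩ := window_step W hn hκ ℓ hℓ hℓn hw₀ hdiv hmean hsupp hBN hℓN hball p q hT hε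
  refine ⟨h1, h2.trans ?_⟩
  have hw : ∀ m : Fin 3 → ℤ, 0 ≤ κ * (4 * Real.pi ^ 2 * freqNormSq m) := fun m =>
    mul_nonneg hκ.le (mul_nonneg (by positivity) (freqNormSq_nonneg _))
  have hΓ0 : ∀ j, 0 ≤ Γ j := by
    intro j
    refine mul_nonneg (mul_nonneg (mul_nonneg (by norm_num) (by positivity)) (by positivity)) (add_nonneg ?_ ?_)
    · exact div_nonneg (by positivity) (hw _)
    · exact div_nonneg (by positivity) (hw _)
  have hn' : (0:ℝ) < n := by exact_mod_cast hn
  have hΛ : 0 < 2 * (κ * (4 * Real.pi ^ 2 * ((n : ℝ) / 2) ^ 2)) := by positivity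
  have hs := sum_le_sum_mul_div Γ (fun j => (W.phase j).τ) hτm hΓ0 hτ
  have e : 4 * (∑ j, (W.phase j).τ * Γ j) / (τm * (2 * (κ * (4 * Real.pi ^ 2 * ((n : ℝ) / 2) ^ 2)))) =
      4 * ((∑ j, (W.phase j).τ * Γ j) / τm) / (2 * (κ * (4 * Real.pi ^ 2 * ((n : ℝ) / 2) ^ 2))) := by
    field_simp
  rw [e]
  gcongr

end Summit.AnomalousDissipation.AnomalousDissipation.Theorems.QuasiStaticSolenoidalCellTensorQ.Negative

end
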